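import Literature.MathematicalPhysics.QuantumFieldTheory.Balaban1983to89.B15Prop1LinearisedKernelDictionary
import Literature.MathematicalPhysics.QuantumFieldTheory.Balaban1983to89.B15Prop1LocalChartFromThm1AtBaseCentral
import Literature.MathematicalPhysics.QuantumFieldTheory.Balaban1983to89.B15Prop1ChartPointCriticalityFromMinimiser

/-!
# `Balaban1983to89.B15Prop1MinimiserFamilyFromThm1AtBaseCentral` — THE CENTRAL EDITION (Theorem 1 at the base datum read with DATUM-PRESERVING, tower-central gauge
# transformations — see `B15Prop1LocalChartFromThm1AtBaseCentral`; the residual-group edition `B15Prop1MinimiserFamilyFromThm1AtBase` asks a letter that is false in general) — [Balaban1985Variational] = «[15]», Thm 1 p. 279, (4) p. 278, (16)–(18) p. 280, Sect. C (45) p. 285, Prop. 8 p. 305,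
# Sect. G pp. 305–307, Prop. 9 (190) p. 309; [Balaban1985RegularSpaces] (1.19) p. 79; [Balaban1989LargeFieldI] Prop. 1 p. 194; [Balaban1989LargeFieldII] (1.9) p. 358:
# THE LETTER (J0′) `hMin` OF THE w1 LINEAGE WITH {(E)-as-letter, `hcritT`, `hT1u`} REPLACED BY THEOREM 1 AT THE BASE DATUM + [15] Prop. 8 at chart points + print's comb forest —
# the editions of `B15Prop1MinimiserFamilyFromRightInverse.hMin_of_rightInverseLetters` (generic) and of the lineage's best theorem
# `B15Prop1LinearisedKernelDictionary.hMin_atRecord_of_node00Letters` (NODE 00's objects) over this seat's g3 chart theorem `exists_localChart_at_baseField_of_thm1AtBase_forest`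

Honest framing: statement-level skeleton of published theorems with citation tags; proofs where landed; nothing here is a claim about the
Yang–Mills mass gap.  Cell `pub-ymgap`, HUMAN RULING D-0149 (width seats), seat `pub-ymgap-dag-n12-w1` (g3; N12 = [B15]; U1a⁺ of the w1 lineage, rule (ii)); `--kind proof
--supports` the K1 item of record; count-neutral; N12 NOT discharged; finite 𝕋⁴ at fixed ε; nothing continuum ∕ ℝ⁴ ∕ OS ∕ mass-gap ∕ Clay.

WHY.  The lineage's reduction of (J0′) (`hMin`: one radius `R`, all base fields `V_k` of a compact `K`, a holomorphic bounded matrix family whose real values are MINIMISERS) ended at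
`hMin_atRecord_of_node00Letters` with, per base field, the letters: minimiser `U₀` + guards, conjugation-stable slice `S`, (45) `hR`, (β) `hposN`, `hcritT` at an abstract `Crit`, and
`hT1u` for ALL nearby data.  This seat's g3 files (`ConstrainedCriticalPointLocallyUnique`, `B15Prop1MinimiserFromBaseUniqueness`, `B15Prop1LocalChartFromThm1AtBase`,
`B15Prop1GaugeSectionOfForest`, `B15Prop1LocalChartFromThm1AtBaseLocal`, `B15Prop1ChartPointCriticalityFromMinimiser`) let `Crit := IsMinimizer`: then `hT1u` is the identity and `hcritT` follows from (T1@q₀)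
THEOREM 1 AT THE BASE DATUM, a forest gauge section (theorem), [15] Prop. 8 at chart points (theorem: `hP8_of_honto`), and kernel topology.  THIS FILE re-threads the chain `hMin_of_localCharts` ← chart theorem ← `honto_of_rightInverse` ∕
`hcrit_of_isMinimizer` ∕ `hH_of_dIterL_rightInverse` ∕ `hnondeg_slice_of_realSecondVariation_pos` ∕ `fderiv_sliceDatum_cplxVec_eq_zero_iff` with the g3 chart theorem in place of
`exists_localChart_at_baseField`.  PER BASE FIELD, THE DISPLAYED LETTERS ARE NOW: a minimiser `U₀` of the base datum's (2.12) problem + the two (0.4) guards; print's comb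
`Ax_k(𝔅_k, U₀)` as a rooted forest `path` with (F1)(F2)(F3) (the slice `S` is ITS axial slice); (45) `hR` — a right inverse from `S` of NODE 00's linearised averaging `Q(U₀)`; (β)
`hposN` — positivity of the real second variation on the real kernel; (T1@q₀) Theorem 1 at the base datum (the residual orbit of `U₀` is the unique minimal orbit over the
closed-reading class `reg'`); and the three class facts about `reg'` (closed, `⊇ closure reg`, the `𝐁`-restricted averages continuous on it — the LOCAL form of
`B15Prop1LocalChartFromThm1AtBaseLocal`, inhabitable at NODE 00's class on the domains).  ([15] Prop. 8 at chart points is the theorem `hP8_of_honto`.)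

CONTENTS (theorems only; no `def`, no `instance`, no `sorry`).  §1 ★★★ `hMin_of_thm1AtBaseLetters_central` (generic `P`, class `reg`; `hH`∕`hnondeg` currency).  §2 ★★★
`hMin_atRecord_of_node00Letters_thm1AtBase_central` (NODE 00's `avOfRecord F 2 Kt` ∕ `regMSCoPOfRecord F 2 ν Kt kc Ω`; `hR` in `dIterL` currency and (β) in real second-variation currency, as in
`hMin_atRecord_of_node00Letters`; the openness of the class is `B15Prop1ClassOpenAtRecord.eventually_mem_regMSCoPOfRecordAt`; Prop. 8 at chart points is `hP8_of_honto`).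
HONEST SCOPE: composition by name; (T1@q₀), `hR`, (β), the forest choice, the class facts stay DISPLAYED — print's analysis, not asserted; count-neutral; N12 NOT discharged; the YM
mass gap (Clay) is NOT proved by any of this — R4 closes only the conditional finite-𝕋⁴ rung `BalabanLadder.UV`.
-/

noncomputable section

namespace Literature.MathematicalPhysics.QuantumFieldTheory.Balaban1983to89.B15Prop1MinimiserFamilyFromThm1AtBaseCentral

open Set Metric Filter
open scoped Topology ComplexConjugate
open Literature.MathematicalPhysics.QuantumFieldTheory.Balaban1983to89.Node00 (SU coeField coeField_apply SmallBelow ConstrSet constrCard constrEnum dIterL)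
open B15AveragingHolomorphic (iterMh)
open B15ComplexifiedDatumFamily (conjVec datumC datumC_real)
open B15SU2ChartHolomorphic (genE expMulC logCoordC)
open B15Prop1MinimiserFamilyPatching (hMin_of_localCharts)
open B15Prop1CriticalChartFromIFT (datumC_coeField_zero)
open B15Prop1ClassOpenAtRecord (eventually_coeField_of_eventually)
open B15Prop1BaseCriticalityFromMinimiser (hcrit_of_isMinimizer)
open B15Prop1OntoFromRightInverse (honto_of_rightInverse)
open B15Prop1SliceNondegeneracyFromRealCoercive (hnondeg_slice_of_realSecondVariation_pos)
open B15Prop1RightInverseFromLinearisedAveraging (hH_of_dIterL_rightInverse)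
open B15Prop1LinearisedKernelDictionary (fderiv_sliceDatum_cplxVec_eq_zero_iff)
open B15Prop1LocalChartFromThm1AtBaseCentral (exists_localChart_at_baseField_of_thm1AtBase_forest_central)
open B15Prop1ChartPointCriticalityFromMinimiser (hP8_of_honto)
open Literature.MathematicalPhysics.QuantumFieldTheory.BalabanImbrieJaffe1984to88.BIJ85Eq453GaugeField (qsstarGIter0)
open B15Prop1AnalyticExtClause (cplxVec)
open B15Prop1ChartCalculusSU2 (E3)
open B15Prop1ChartSU2 (su2Chart)
open B15ShellGauge193 (shellGauge)
open B15Extension193 (extend)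
open B16Sect1Backgrounds (toMS expMul)
open ExpMeanLog (expMeanLogSU)
open BlockAveraging (blockAvg)
open T4CubeChartGnomonic (SU2)
open T4Continuum B15DeterminingSets GaugeField
open scoped Matrix.Norms.L2Operator

/-! ## §1  Generic: the letter (J0′) `hMin` from Theorem 1 at each base datum -/

section Generic

variable {P : Params} {k : ℕ}

/-- ★★★ **THE LETTER (J0′) `hMin` FROM THEOREM 1 AT EACH BASE DATUM** — `B15Prop1MinimiserFamilyFromRightInverse.hMin_of_rightInverseLetters` with, per base field `V_k ∈ K`, the
conjugation-stable slice replaced by the axial slice of a rooted FOREST `path` ((F1) prefix∕orientation, (F2) roots at the block towers of the constrained bonds, (F3) slice), and the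
letters `hcritT` (abstract `Crit`) and `hT1u` replaced by (T1@q₀) THEOREM 1 AT THE BASE DATUM ([15] Prop. 8 at chart points is derived inside from `honto` and the openness of the class); plus the three class facts about a
closed-reading class `reg' ⊇ closure reg` and `k ≤ m + K`.  Kept: the minimiser `U₀` with `reg` open at it, the guards, `a`, `Φ₀`, the real right inverse `hH` ((45), velocity
currency) and (β) `hnondeg` for every multiplier of the base state.  Same conclusion (one radius `R` for all of `K`; a holomorphic bounded matrix family of MINIMISERS).
[cite: Balaban1985Variational, Thm 1 p.279, (4) p.278, (16)–(18) p.280, Sect. C (45),(47)–(48) p.285, Prop. 8 p.305, Sect. G pp.305–307, Prop. 9 (190) p.309; Balaban1985RegularSpaces, (1.19) p.79; Balaban1989LargeFieldI, (1.74) p.192, Prop. 1 p.194 (last clause); Balaban1989LargeFieldII, (1.9) p.358; Balaban1988Convergent, (2.10)–(2.14) pp.256–257] -/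
theorem hMin_of_thm1AtBaseLetters_central (Λ : Set (Site P k)) (lo hi : Fin P.d → ℤ)
    (reg reg' : Set (GaugeField P 0 SU2)) (𝔹 : DetSet P) (h𝔹 : ∀ j, k < j → 𝔹 j = ∅) (hk : k ≤ P.m + P.K)
    (ext : GaugeField P k SU2 → GaugeField P k SU2) (hext : ∀ W, ext W = extend Λ (shellGauge W lo hi) W)
    {K : Set (GaugeField P k SU2)} (hK : IsCompact K) {𝓐₀ : ℝ} (h𝓐₀ : 1 < 𝓐₀)
    -- the three CLASS facts: the closed-reading class `reg'` (closed, containing `closure reg`, the `𝐁`-restricted averages continuous on it)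
    (hreg' : IsClosed reg') (hcl : closure reg ⊆ reg')
    (hDreg' : ContinuousOn (fun (U : GaugeField P 0 SU2) (i : Fin (constrCard 𝔹 k)) =>
      ((avgFamily (fun j => blockAvg (P := P) (j := j) expMeanLogSU) U ((constrEnum 𝔹 k).symm i).1 ((constrEnum 𝔹 k).symm i).2.1 : SU2) :
        Matrix (Fin 2) (Fin 2) ℂ)) reg')
    (hbase : ∀ Vk ∈ K, ∃ (U₀ : GaugeField P 0 SU2) (S : Submodule ℂ (VecField P 0 (EuclideanSpace ℂ (Fin 3)))) (path : Site P 0 → List (LStep P 0))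
        (a : S → ℂ) (Φ₀ : S → Fin (constrCard 𝔹 k) → EuclideanSpace ℂ (Fin 3)),
      -- the base configuration is a MINIMISER of the base datum's (2.12) problem over `reg`, and `reg` is open at it ([15] Thm 1 existence; class (6) open)
      IsMinimizer (fun j => blockAvg (P := P) (j := j) expMeanLogSU) reg 𝔹
        (avgFamily (fun j => blockAvg (P := P) (j := j) expMeanLogSU) (qsstarGIter0 k (ext Vk))) U₀ ∧
      (∀ᶠ U in 𝓝 U₀, U ∈ reg) ∧
      SmallBelow (fun j => blockAvg (P := P) (j := j) expMeanLogSU) k (qsstarGIter0 k (ext Vk)) ∧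
      SmallBelow (fun j => blockAvg (P := P) (j := j) expMeanLogSU) k U₀ ∧
      -- the slice is the axial slice of a rooted forest: (F1) prefix∕orientation, (F2) roots at the block towers of the constrained bonds, (F3) slice
      (∀ x, ∀ s ∈ path x, ∃ x' x'' : Site P 0, path x'' = path x' ++ [s] ∧
        (s.fwd = true → s.bond.src = x' ∧ s.bond.tgt = x'') ∧ (s.fwd = false → s.bond.src = x'' ∧ s.bond.tgt = x')) ∧
      (∀ j, j ≤ k → ∀ c ∈ bondsOf (𝔹 j), path (embIter j c.src) = [] ∧ path (embIter j c.tgt) = []) ∧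
      (∀ X : VecField P 0 (EuclideanSpace ℂ (Fin 3)), X ∈ S ↔ ∀ x, ∀ s ∈ path x, X s.bond = 0) ∧
      (∀ X : S, a X = ∑ p : Plaq P 0, (1 - (expMulC (X : VecField P 0 (EuclideanSpace ℂ (Fin 3))) (coeField U₀) ⟨p.src, p.μ⟩ *
        expMulC (X : VecField P 0 (EuclideanSpace ℂ (Fin 3))) (coeField U₀) ⟨p.src.shift p.μ, p.ν⟩ *
        Matrix.adjugate (expMulC (X : VecField P 0 (EuclideanSpace ℂ (Fin 3))) (coeField U₀) ⟨p.src.shift p.ν, p.μ⟩) *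
        Matrix.adjugate (expMulC (X : VecField P 0 (EuclideanSpace ℂ (Fin 3))) (coeField U₀) ⟨p.src, p.ν⟩)).trace / 2)) ∧
      (∀ (X : S) i, Φ₀ X i = logCoordC (star ((avgFamily (fun j => blockAvg (P := P) (j := j) expMeanLogSU) (qsstarGIter0 k (ext Vk))
        ((constrEnum 𝔹 k).symm i).1 ((constrEnum 𝔹 k).symm i).2.1 : SU2) : Matrix (Fin 2) (Fin 2) ℂ) *
        iterMh ((constrEnum 𝔹 k).symm i).1 (expMulC (X : VecField P 0 (EuclideanSpace ℂ (Fin 3))) (coeField U₀)) ((constrEnum 𝔹 k).symm i).2.1)) ∧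
      -- DISPLAYED ([15] (45)): a REAL right inverse of the linearised multi-scale averaging from the slice, velocity currency
      (∀ τ : Fin (constrCard 𝔹 k) → EuclideanSpace ℝ (Fin 3), ∃ p : VecField P 0 E3, cplxVec p ∈ S ∧
        ∀ i : Fin (constrCard 𝔹 k), HasDerivAt (fun s : ℝ => ((avgFamily (fun j => blockAvg (P := P) (j := j) expMeanLogSU) (expMul su2Chart (s • p) U₀)
          ((constrEnum 𝔹 k).symm i).1 ((constrEnum 𝔹 k).symm i).2.1 : SU2) : Matrix (Fin 2) (Fin 2) ℂ))
          (((avgFamily (fun j => blockAvg (P := P) (j := j) expMeanLogSU) (qsstarGIter0 k (ext Vk)) ((constrEnum 𝔹 k).symm i).1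
            ((constrEnum 𝔹 k).symm i).2.1 : SU2) : Matrix (Fin 2) (Fin 2) ℂ) * ∑ b : Fin 3, ((τ i b : ℝ) : ℂ) • genE b) 0) ∧
      -- DISPLAYED ((β)): the Lagrange Hessian is nondegenerate on `ker DΦ₀(0)`, for every multiplier of the base state
      (∀ ℓ₀ : (Fin (constrCard 𝔹 k) → EuclideanSpace ℂ (Fin 3)) →L[ℂ] ℂ, fderiv ℂ a 0 = ℓ₀.comp (fderiv ℂ Φ₀ 0) →
        ∀ s : S, fderiv ℂ Φ₀ 0 s = 0 →
          (∀ t : S, fderiv ℂ Φ₀ 0 t = 0 → fderiv ℂ (fderiv ℂ a) 0 s t - ℓ₀ (fderiv ℂ (fderiv ℂ Φ₀) 0 s t) = 0) → s = 0) ∧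
      -- DISPLAYED (T1@q₀): Theorem 1 at the base datum — the DATUM-PRESERVING (central at the 𝐁-towers) orbit of `U₀` is the unique minimal orbit over `reg'`
      (∀ U ∈ reg', AgreeOn 𝔹 (avgFamily (fun j => blockAvg (P := P) (j := j) expMeanLogSU) U) (avgFamily (fun j => blockAvg (P := P) (j := j) expMeanLogSU) (qsstarGIter0 k (ext Vk))) →
        wilsonAction4 U ≤ wilsonAction4 U₀ →
          ∃ u : GaugeTransf P 0 SU2, (∀ j, j ≤ k → ∀ b ∈ bondsOf (𝔹 j), toMS u j b.src = toMS u j b.tgt ∧ ∀ g : SU2, toMS u j b.src * g = g * toMS u j b.src) ∧ gaugeAct u U = U₀)) :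
    ∃ R : ℝ, 0 < R ∧ ∀ Vk ∈ K,
      ∃ Ũ : VecField P k (EuclideanSpace ℂ (Fin 3)) × VecField P k (EuclideanSpace ℂ (Fin 3)) → PBond P 0 → Matrix (Fin 2) (Fin 2) ℂ,
        (∀ b i j, DifferentiableOn ℂ (fun z => Ũ z b i j) (ball 0 R)) ∧
        (∀ z ∈ ball (0 : VecField P k (EuclideanSpace ℂ (Fin 3)) × VecField P k (EuclideanSpace ℂ (Fin 3))) R, ∀ b i j, ‖Ũ z b i j‖ ≤ 𝓐₀) ∧
        ∀ p B' : VecField P k E3, ‖p‖ < R → ‖B'‖ < R → ∃ U' : GaugeField P 0 SU2,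
          (∀ b, Ũ (cplxVec p, cplxVec B') b = ((U' b : SU2) : Matrix (Fin 2) (Fin 2) ℂ)) ∧
            IsMinimizer (fun j => blockAvg (P := P) (j := j) expMeanLogSU) reg 𝔹
              (avgFamily (fun j => blockAvg (P := P) (j := j) expMeanLogSU) (qsstarGIter0 k (expMul su2Chart B' (ext (expMul su2Chart p Vk))))) U' := by
  refine hMin_of_localCharts Λ lo hi (fun j => blockAvg (P := P) (j := j) expMeanLogSU) reg 𝔹 ext hK fun Vk hVk => ?_
  obtain ⟨U₀, S, path, a, Φ₀, hmin, hregopen, hsbQ, hsbU, hF1, hF2, hF3, ha, hΦ₀, hH, hnondeg, hT1⟩ := hbase Vk hVk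
  have hU₀ : AgreeOn 𝔹 (avgFamily (fun j => blockAvg (P := P) (j := j) expMeanLogSU) U₀)
      (avgFamily (fun j => blockAvg (P := P) (j := j) expMeanLogSU) (qsstarGIter0 k (ext Vk))) := hmin.2.1
  have hS : ∀ X ∈ S, conjVec X ∈ S := fun X hX => (hF3 _).2 fun x s hs => by
    have h0 : X s.bond = 0 := (hF3 X).1 hX x s hs
    ext a
    simp [conjVec, h0]
  -- the datum coordinates, pointwise
  set κ : (PBond P 0 → Matrix (Fin 2) (Fin 2) ℂ) → Fin (constrCard 𝔹 k) → EuclideanSpace ℂ (Fin 3) := fun Q i =>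
    logCoordC (star ((avgFamily (fun j => blockAvg (P := P) (j := j) expMeanLogSU) (qsstarGIter0 k (ext Vk)) ((constrEnum 𝔹 k).symm i).1
      ((constrEnum 𝔹 k).symm i).2.1 : SU2) : Matrix (Fin 2) (Fin 2) ℂ) * iterMh ((constrEnum 𝔹 k).symm i).1 Q ((constrEnum 𝔹 k).symm i).2.1) with hκdef
  have hκ : ∀ Q i, κ Q i = logCoordC (star ((avgFamily (fun j => blockAvg (P := P) (j := j) expMeanLogSU) (qsstarGIter0 k (ext Vk)) ((constrEnum 𝔹 k).symm i).1
      ((constrEnum 𝔹 k).symm i).2.1 : SU2) : Matrix (Fin 2) (Fin 2) ℂ) * iterMh ((constrEnum 𝔹 k).symm i).1 Q ((constrEnum 𝔹 k).symm i).2.1) := fun Q i => rfl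
  have hΦ₀κ : ∀ X : S, Φ₀ X = κ (expMulC (X : VecField P 0 (EuclideanSpace ℂ (Fin 3))) (coeField U₀)) := fun X => funext fun i => by rw [hΦ₀, hκ]
  -- `honto` from the right inverse, `hcrit` from minimality, `hclass` from openness
  have honto : Function.Surjective (fderiv ℂ Φ₀ 0) :=
    honto_of_rightInverse 𝔹 k _ κ hκ hsbU hU₀ S Φ₀ hΦ₀κ hH
  obtain ⟨ℓ₀, hcrit⟩ := hcrit_of_isMinimizer 𝔹 k h𝔹 reg hsbQ hsbU hmin hregopen S hS a ha Φ₀ hΦ₀ honto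
  have hclass : ∀ᶠ Q in 𝓝 (coeField U₀), ∀ U' : GaugeField P 0 SU2, coeField U' = Q → U' ∈ reg := eventually_coeField_of_eventually hregopen
  -- the local chart at this base field from Theorem 1 at the base datum (this lineage's g3 chart theorem), then the bookkeeping of `hMin_of_localCharts`
  -- (P8) [15] Prop. 8 at chart points: a THEOREM (`B15Prop1ChartPointCriticalityFromMinimiser.hP8_of_honto`)
  have hP8 := hP8_of_honto 𝔹 k h𝔹 reg hsbU hU₀ S hS a ha Φ₀ hΦ₀ honto hclass
  obtain ⟨O, hO, hmem, Γ, hΓd, hΓb, hΓr⟩ := exists_localChart_at_baseField_of_thm1AtBase_forest_central 𝔹 k hk h𝔹 reg hsbQ hsbU hU₀ S path hF1 hF2 hF3 a ha Φ₀ hΦ₀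
    hcrit honto (hnondeg ℓ₀ hcrit) hclass reg' hreg' hcl hDreg' hT1 hP8 h𝓐₀
  refine ⟨O, hO, by rwa [datumC_coeField_zero Λ lo hi ext hext], Γ, hΓd, hΓb, fun p B' Vk' hQ' => ?_⟩
  have hreal : datumC Λ lo hi (coeField Vk') (cplxVec p) (cplxVec B') =
      coeField (qsstarGIter0 k (expMul su2Chart B' (ext (expMul su2Chart p Vk')))) := by
    rw [datumC_real, ← hext]
  rw [hreal] at hQ' ⊢
  exact hΓr _ hQ'

end Generic

/-! ## §2  At NODE 00's objects: the lineage's best theorem, Theorem-1-at-the-base edition -/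

section Record

variable {F : T4Family} {k : ℕ}

/-- ★★★ **THE LETTER (J0′) `hMin` AT NODE 00's OBJECTS FROM THEOREM 1 AT EACH BASE DATUM** — `B15Prop1LinearisedKernelDictionary.hMin_atRecord_of_node00Letters` (NODE 00's
`avOfRecord F 2 Kt` ∕ `regMSCoPOfRecord F 2 ν Kt kc Ω`; (45) `hR` in `dIterL` currency; (β) `hposN` in real second-variation currency on the real kernel of `Q(U₀)`) with the
conjugation-stable slice replaced by the axial slice of a rooted forest ((F1)(F2)(F3)) and {`hcritT`, `hT1u`} replaced by (T1@q₀) Theorem 1 at the base datum + the three class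
facts about `reg'` + `k ≤ m + K`. [cite: Balaban1985Variational, Thm 1 p.279, (3)–(4) p.278, (16)–(18) p.280, Sect. C (44)–(48) p.285, (82)–(83) p.290, Prop. 8 p.305, Sect. G pp.305–307, Prop. 9 (190) p.309; Balaban1985RegularSpaces, (1.19) p.79; Balaban1989LargeFieldI, (1.74) p.192, Prop. 1 p.194; Balaban1989LargeFieldII, (1.9) p.358, (1.12) p.359; Balaban1988Convergent, (2.10)–(2.12) p.256] -/
theorem hMin_atRecord_of_node00Letters_thm1AtBase_central (ν : Node00.Stage7Numerics) (Kt kc : ℕ) (Ω : ℕ → Set (Site (F.P Kt) 0))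
    (Λ : Set (Site (F.P Kt) k)) (lo hi : Fin (F.P Kt).d → ℤ) (𝔹 : DetSet (F.P Kt)) (h𝔹 : ∀ j, k < j → 𝔹 j = ∅) (hk : k ≤ (F.P Kt).m + (F.P Kt).K)
    (ext : GaugeField (F.P Kt) k SU2 → GaugeField (F.P Kt) k SU2) (hext : ∀ W, ext W = extend Λ (shellGauge W lo hi) W)
    {K : Set (GaugeField (F.P Kt) k SU2)} (hK : IsCompact K) {𝓐₀ : ℝ} (h𝓐₀ : 1 < 𝓐₀)
    -- the three CLASS facts: a closed-reading class `reg'` containing the closure of NODE 00's class, on which the `𝐁`-restricted averages are continuous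
    (reg' : Set (GaugeField (F.P Kt) 0 SU2)) (hreg' : IsClosed reg') (hcl : closure (Node00.regMSCoPOfRecord F 2 ν Kt kc Ω) ⊆ reg')
    (hDreg' : ContinuousOn (fun (U : GaugeField (F.P Kt) 0 SU2) (i : Fin (constrCard 𝔹 k)) =>
      ((avgFamily (Node00.avOfRecord F 2 Kt) U ((constrEnum 𝔹 k).symm i).1 ((constrEnum 𝔹 k).symm i).2.1 : SU2) : Matrix (Fin 2) (Fin 2) ℂ)) reg')
    (hbase : ∀ Vk ∈ K, ∃ (U₀ : GaugeField (F.P Kt) 0 SU2) (S : Submodule ℂ (VecField (F.P Kt) 0 (EuclideanSpace ℂ (Fin 3)))) (path : Site (F.P Kt) 0 → List (LStep (F.P Kt) 0))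
        (a : S → ℂ) (Φ₀ : S → Fin (constrCard 𝔹 k) → EuclideanSpace ℂ (Fin 3)),
      IsMinimizer (Node00.avOfRecord F 2 Kt) (Node00.regMSCoPOfRecord F 2 ν Kt kc Ω) 𝔹
        (avgFamily (Node00.avOfRecord F 2 Kt) (qsstarGIter0 k (ext Vk))) U₀ ∧
      SmallBelow (Node00.avOfRecord F 2 Kt) k (qsstarGIter0 k (ext Vk)) ∧
      SmallBelow (Node00.avOfRecord F 2 Kt) k U₀ ∧
      -- the slice is the axial slice of a rooted forest: (F1), (F2), (F3)
      (∀ x, ∀ s ∈ path x, ∃ x' x'' : Site (F.P Kt) 0, path x'' = path x' ++ [s] ∧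
        (s.fwd = true → s.bond.src = x' ∧ s.bond.tgt = x'') ∧ (s.fwd = false → s.bond.src = x'' ∧ s.bond.tgt = x')) ∧
      (∀ j, j ≤ k → ∀ c ∈ bondsOf (𝔹 j), path (embIter j c.src) = [] ∧ path (embIter j c.tgt) = []) ∧
      (∀ X : VecField (F.P Kt) 0 (EuclideanSpace ℂ (Fin 3)), X ∈ S ↔ ∀ x, ∀ s ∈ path x, X s.bond = 0) ∧
      (∀ X : S, a X = ∑ p : Plaq (F.P Kt) 0, (1 - (expMulC (X : VecField (F.P Kt) 0 (EuclideanSpace ℂ (Fin 3))) (coeField U₀) ⟨p.src, p.μ⟩ *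
        expMulC (X : VecField (F.P Kt) 0 (EuclideanSpace ℂ (Fin 3))) (coeField U₀) ⟨p.src.shift p.μ, p.ν⟩ *
        Matrix.adjugate (expMulC (X : VecField (F.P Kt) 0 (EuclideanSpace ℂ (Fin 3))) (coeField U₀) ⟨p.src.shift p.ν, p.μ⟩) *
        Matrix.adjugate (expMulC (X : VecField (F.P Kt) 0 (EuclideanSpace ℂ (Fin 3))) (coeField U₀) ⟨p.src, p.ν⟩)).trace / 2)) ∧
      (∀ (X : S) i, Φ₀ X i = logCoordC (star ((avgFamily (Node00.avOfRecord F 2 Kt) (qsstarGIter0 k (ext Vk))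
        ((constrEnum 𝔹 k).symm i).1 ((constrEnum 𝔹 k).symm i).2.1 : SU2) : Matrix (Fin 2) (Fin 2) ℂ) *
        iterMh ((constrEnum 𝔹 k).symm i).1 (expMulC (X : VecField (F.P Kt) 0 (EuclideanSpace ℂ (Fin 3))) (coeField U₀)) ((constrEnum 𝔹 k).symm i).2.1)) ∧
      -- DISPLAYED ([15] (45), LINEAR currency): a right inverse of the linearised multi-scale averaging `Q(U₀)` from the slice
      (∀ τ : Fin (constrCard 𝔹 k) → EuclideanSpace ℝ (Fin 3), ∃ p : VecField (F.P Kt) 0 E3, cplxVec p ∈ S ∧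
        ∀ i : Fin (constrCard 𝔹 k), dIterL ((constrEnum 𝔹 k).symm i).1 (coeField U₀)
          (fun b => (∑ a : Fin 3, ((p b a : ℝ) : ℂ) • genE a) * ((U₀ b : SU2) : Matrix (Fin 2) (Fin 2) ℂ)) ((constrEnum 𝔹 k).symm i).2.1 =
          ((avgFamily (Node00.avOfRecord F 2 Kt) (qsstarGIter0 k (ext Vk)) ((constrEnum 𝔹 k).symm i).1
            ((constrEnum 𝔹 k).symm i).2.1 : SU2) : Matrix (Fin 2) (Fin 2) ℂ) * ∑ b : Fin 3, ((τ i b : ℝ) : ℂ) • genE b) ∧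
      -- DISPLAYED ((β), REAL currency, kernel in `Q(U₀)` currency): positivity of the real second variation of the Lagrangian on the real kernel of the linearised averaging
      (∀ ℓ₀ : (Fin (constrCard 𝔹 k) → EuclideanSpace ℂ (Fin 3)) →L[ℂ] ℂ, fderiv ℂ a 0 = ℓ₀.comp (fderiv ℂ Φ₀ 0) →
        ∀ (p : VecField (F.P Kt) 0 E3) (hp : cplxVec p ∈ S), p ≠ 0 →
          (∀ i : Fin (constrCard 𝔹 k), dIterL ((constrEnum 𝔹 k).symm i).1 (coeField U₀)
            (fun b => (∑ a : Fin 3, ((p b a : ℝ) : ℂ) • genE a) * ((U₀ b : SU2) : Matrix (Fin 2) (Fin 2) ℂ)) ((constrEnum 𝔹 k).symm i).2.1 = 0) →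
          0 < deriv (deriv (fun t : ℝ => wilsonAction4 (expMul su2Chart (t • p) U₀) - (ℓ₀ (Φ₀ ((t : ℂ) • ⟨cplxVec p, hp⟩))).re)) 0) ∧
      -- DISPLAYED (T1@q₀): Theorem 1 at the base datum — the DATUM-PRESERVING (central at the 𝐁-towers) orbit of `U₀` is the unique minimal orbit over `reg'`
      (∀ U ∈ reg', AgreeOn 𝔹 (avgFamily (Node00.avOfRecord F 2 Kt) U) (avgFamily (Node00.avOfRecord F 2 Kt) (qsstarGIter0 k (ext Vk))) →
        wilsonAction4 U ≤ wilsonAction4 U₀ →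
          ∃ u : GaugeTransf (F.P Kt) 0 SU2, (∀ j, j ≤ k → ∀ b ∈ bondsOf (𝔹 j), toMS u j b.src = toMS u j b.tgt ∧ ∀ g : SU2, toMS u j b.src * g = g * toMS u j b.src) ∧ gaugeAct u U = U₀)) :
    ∃ R : ℝ, 0 < R ∧ ∀ Vk ∈ K,
      ∃ Ũ : VecField (F.P Kt) k (EuclideanSpace ℂ (Fin 3)) × VecField (F.P Kt) k (EuclideanSpace ℂ (Fin 3)) → PBond (F.P Kt) 0 → Matrix (Fin 2) (Fin 2) ℂ,
        (∀ b i j, DifferentiableOn ℂ (fun z => Ũ z b i j) (ball 0 R)) ∧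
        (∀ z ∈ ball (0 : VecField (F.P Kt) k (EuclideanSpace ℂ (Fin 3)) × VecField (F.P Kt) k (EuclideanSpace ℂ (Fin 3))) R, ∀ b i j, ‖Ũ z b i j‖ ≤ 𝓐₀) ∧
        ∀ p B' : VecField (F.P Kt) k E3, ‖p‖ < R → ‖B'‖ < R → ∃ U' : GaugeField (F.P Kt) 0 SU2,
          (∀ b, Ũ (cplxVec p, cplxVec B') b = ((U' b : SU2) : Matrix (Fin 2) (Fin 2) ℂ)) ∧
            IsMinimizer (Node00.avOfRecord F 2 Kt) (Node00.regMSCoPOfRecord F 2 ν Kt kc Ω) 𝔹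
              (avgFamily (Node00.avOfRecord F 2 Kt) (qsstarGIter0 k (expMul su2Chart B' (ext (expMul su2Chart p Vk))))) U' :=
  hMin_of_thm1AtBaseLetters_central Λ lo hi (Node00.regMSCoPOfRecord F 2 ν Kt kc Ω) reg' 𝔹 h𝔹 hk ext hext hK h𝓐₀ hreg' hcl hDreg'
    (fun Vk hVk => by
      obtain ⟨U₀, S, path, a, Φ₀, hmin, hsbQ, hsbU, hF1, hF2, hF3, ha, hΦ₀, hR, hposN, hT1⟩ := hbase Vk hVk
      have hS : ∀ X ∈ S, conjVec X ∈ S := fun X hX => (hF3 _).2 fun x s hs => by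
        have h0 : X s.bond = 0 := (hF3 X).1 hX x s hs
        ext a
        simp [conjVec, h0]
      refine ⟨U₀, S, path, a, Φ₀, hmin, B15Prop1ClassOpenAtRecord.eventually_mem_regMSCoPOfRecordAt F 2 ν Kt kc _ Ω hmin.1, hsbQ, hsbU, hF1, hF2, hF3, ha, hΦ₀,
        hH_of_dIterL_rightInverse 𝔹 k _ hsbU S hR, fun ℓ₀ hℓ₀ => ?_, hT1⟩
      exact hnondeg_slice_of_realSecondVariation_pos 𝔹 k _ hsbU hmin.2.1 S hS a ha Φ₀ hΦ₀ ℓ₀ fun p hp hne hker =>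
        hposN ℓ₀ hℓ₀ p hp hne ((fderiv_sliceDatum_cplxVec_eq_zero_iff 𝔹 k _ hsbU hmin.2.1 S hΦ₀ hp).1 hker))

end Record

end Literature.MathematicalPhysics.QuantumFieldTheory.Balaban1983to89.B15Prop1MinimiserFamilyFromThm1AtBaseCentral

end
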